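import Mathlib
import HarnessLib

/-!
# `S₄ ≅ PGL₂(𝔽₃)` via the action on `ℙ¹(𝔽₃)` (helper for item stmt-Langlands-13759, route PicardMuOrdinary)

Helper file for the item `ResidualAutomorphyOdd` of the route `PicardMuOrdinary`: the four points
of `ℙ¹(𝔽₃)` (`pt`, `ptEquiv : Fin 4 ≃ ℙ¹(𝔽₃)`), the permutation action `permHom : GL₂(𝔽₃) →* S₄`
computed from the entries (`permHom_apply`), its kernel (the scalars, `permHom_eq_one_iff`), the
induced isomorphism `thetaPGL : S₄ ≃* PGL₂(𝔽₃)` and matrix lifts of permutations (`exists_gl_of_perm`).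
All finite verifications are `decide` over the entries of a matrix.
-/

set_option linter.dupNamespace false -- project-wide option (lakefile weak.linter.dupNamespace); `Summit.Langlands.Langlands` is the mandated namespace

noncomputable section

open scoped MatrixGroups Polynomial
open Polynomial Matrix

namespace Summit.Langlands.Langlands.Theorems.ResidualAutomorphyOdd

/-! ### `ℙ¹(𝔽₃)` -/

/-- The field with three elements. -/
abbrev F3 : Type := ZMod 3

/-- The plane `𝔽₃²`. -/
abbrev V3 : Type := Fin 2 → F3

/-- The projective line over `𝔽₃`. -/
abbrev P3 : Type := Projectivization F3 V3

/-- First coordinates of representatives of the four points of `ℙ¹(𝔽₃)`. -/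
def vx (i : Fin 4) : F3 := if i = 1 then 0 else 1

/-- Second coordinates of representatives of the four points of `ℙ¹(𝔽₃)`. -/
def vy (i : Fin 4) : F3 := if i = 0 then 0 else if i = 1 then 1 else if i = 2 then 1 else 2

/-- Representatives of the four points of `ℙ¹(𝔽₃)`: `(1,0), (0,1), (1,1), (1,2)`. -/
def vec (i : Fin 4) : V3 := ![vx i, vy i]

/-- The representative vectors are non-zero. -/
theorem vec_ne_zero (i : Fin 4) : vec i ≠ 0 := by
  intro h
  have h0 := congrFun h 0
  have h1 := congrFun h 1
  simp only [vec, Matrix.cons_val_zero, Matrix.cons_val_one, Pi.zero_apply] at h0 h1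
  revert h0 h1
  revert i
  decide

/-- The four points of `ℙ¹(𝔽₃)`. -/
def pt (i : Fin 4) : P3 := Projectivization.mk F3 (vec i) (vec_ne_zero i)

/-- The line through a vector `(x, y) ≠ 0` of `𝔽₃²`, as an index in `Fin 4` (junk value at `0`);
note `y⁻¹ = y` for `y ∈ 𝔽₃ˣ`, so `x / y = x y`. -/
def lineOf (x y : F3) : Fin 4 :=
  if y = 0 then 0 else if x * y = 0 then 1 else if x * y = 1 then 2 else 3

/-- When a multiple of a representative vector has prescribed coordinates. -/
theorem smul_vec_eq_iff (a : F3) (i : Fin 4) (x y : F3) :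
    a • vec i = ![x, y] ↔ a * vx i = x ∧ a * vy i = y := by
  constructor
  · intro h
    exact ⟨by simpa [vec] using congrFun h 0, by simpa [vec] using congrFun h 1⟩
  · rintro ⟨h0, h1⟩
    ext j
    fin_cases j <;> simp [vec, h0, h1]

/-- Every non-zero vector is a multiple of the representative of its line. -/
theorem exists_smul_vec_lineOf (x y : F3) (h : ¬ (x = 0 ∧ y = 0)) :
    ∃ a : F3, a * vx (lineOf x y) = x ∧ a * vy (lineOf x y) = y := by
  revert h; revert x y; decide

/-- The point of a non-zero vector is the point of its line. -/
theorem mk_eq_pt_lineOf (x y : F3) (h : (![x, y] : V3) ≠ 0) :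
    Projectivization.mk F3 ![x, y] h = pt (lineOf x y) := by
  unfold pt
  rw [Projectivization.mk_eq_mk_iff']
  have h' : ¬ (x = 0 ∧ y = 0) := by
    rintro ⟨rfl, rfl⟩
    exact h (by ext j; fin_cases j <;> simp)
  obtain ⟨a, ha⟩ := exists_smul_vec_lineOf x y h'
  exact ⟨a, (smul_vec_eq_iff a _ x y).2 ha⟩

/-- The four points are distinct. -/
theorem pt_injective : Function.Injective pt := by
  intro i j h
  unfold pt at h
  rw [Projectivization.mk_eq_mk_iff'] at h
  obtain ⟨a, ha⟩ := h
  have ha' := (smul_vec_eq_iff a j (vx i) (vy i)).1 (by simpa [vec] using ha)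
  revert ha'
  revert a i j
  decide

/-- `ℙ¹(𝔽₃)` is a finite type. -/
instance : Fintype P3 := Fintype.ofFinite P3

/-- `ℙ¹(𝔽₃)` has four points. -/
theorem card_P3 : Fintype.card P3 = 4 := by
  have h := Projectivization.card_of_finrank_two (k := F3) (V := V3) (by simp)
  rw [Nat.card_eq_fintype_card] at h
  rw [h]
  simp

/-- `Fin 4 ≃ ℙ¹(𝔽₃)`. -/
def ptEquiv : Fin 4 ≃ P3 :=
  Equiv.ofBijective pt ((Fintype.bijective_iff_injective_and_card pt).2 ⟨pt_injective, by simp [card_P3]⟩)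

/-- Unfolding `ptEquiv`. -/
@[simp] theorem ptEquiv_apply (i : Fin 4) : ptEquiv i = pt i := rfl

/-! ### The permutation action of `GL₂(𝔽₃)` on the four points -/

/-- `GL₂(𝔽₃)` acting on `ℙ¹(𝔽₃)`. -/
def actGL : GL (Fin 2) F3 →* Equiv.Perm P3 :=
  (MulAction.toPermHom (LinearMap.GeneralLinearGroup F3 V3) P3).comp
    (Matrix.GeneralLinearGroup.toLin : GL (Fin 2) F3 ≃* _).toMonoidHom

/-- An invertible matrix sends non-zero vectors to non-zero vectors. -/
theorem mulVec_ne_zero (g : GL (Fin 2) F3) {v : V3} (hv : v ≠ 0) :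
    (g : Matrix (Fin 2) (Fin 2) F3) *ᵥ v ≠ 0 := by
  intro h
  apply hv
  have h2 := congrArg (fun w => ((g⁻¹ : GL (Fin 2) F3) : Matrix (Fin 2) (Fin 2) F3) *ᵥ w) h
  simp only [Matrix.mulVec_mulVec, Matrix.mulVec_zero] at h2
  rw [← Matrix.GeneralLinearGroup.coe_mul, inv_mul_cancel, Matrix.GeneralLinearGroup.coe_one,
    Matrix.one_mulVec] at h2
  exact h2

/-- The action of `GL₂(𝔽₃)` on points, on representatives. -/
theorem actGL_mk (g : GL (Fin 2) F3) (v : V3) (hv : v ≠ 0) :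
    actGL g (Projectivization.mk F3 v hv) =
      Projectivization.mk F3 ((g : Matrix (Fin 2) (Fin 2) F3) *ᵥ v) (mulVec_ne_zero g hv) := by
  simp only [actGL, MonoidHom.coe_comp, MulEquiv.coe_toMonoidHom, Function.comp_apply,
    MulAction.toPermHom_apply, MulAction.toPerm_apply, Projectivization.smul_mk]
  congr 1

/-- `GL₂(𝔽₃)` acting on `Fin 4 ≃ ℙ¹(𝔽₃)`. -/
def permHom : GL (Fin 2) F3 →* Equiv.Perm (Fin 4) :=
  (ptEquiv.symm.permCongrHom).toMonoidHom.comp actGL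

/-- The computable action on `Fin 4` in terms of the matrix entries. -/
def actFin (a b c d : F3) (i : Fin 4) : Fin 4 :=
  lineOf (a * vx i + b * vy i) (c * vx i + d * vy i)

/-- The image of a representative vector, in coordinates. -/
theorem mulVec_vec (g : GL (Fin 2) F3) (i : Fin 4) :
    (g : Matrix (Fin 2) (Fin 2) F3) *ᵥ vec i =
      ![g 0 0 * vx i + g 0 1 * vy i, g 1 0 * vx i + g 1 1 * vy i] := by
  ext j
  fin_cases j <;> simp [vec, Matrix.mulVec, dotProduct, Fin.sum_univ_two]

/-- The permutation induced by `g`, computed from the entries of `g`. -/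
theorem permHom_apply (g : GL (Fin 2) F3) (i : Fin 4) :
    permHom g i = actFin (g 0 0) (g 0 1) (g 1 0) (g 1 1) i := by
  change ptEquiv.symm ((actGL g) (ptEquiv.symm.symm i)) = actFin (g 0 0) (g 0 1) (g 1 0) (g 1 1) i
  rw [Equiv.symm_symm, Equiv.symm_apply_eq, ptEquiv_apply, ptEquiv_apply, pt, actGL_mk]
  have key : Projectivization.mk F3 ((g : Matrix (Fin 2) (Fin 2) F3) *ᵥ vec i) (mulVec_ne_zero g (vec_ne_zero i)) =
      Projectivization.mk F3 ![g 0 0 * vx i + g 0 1 * vy i, g 1 0 * vx i + g 1 1 * vy i]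
        (by rw [← mulVec_vec]; exact mulVec_ne_zero g (vec_ne_zero i)) := by
    congr 1
    exact mulVec_vec g i
  rw [key, mk_eq_pt_lineOf]
  rfl

/-! ### The kernel is the centre; `S₄ ≅ PGL₂(𝔽₃)` -/

/-- A matrix fixes all four points iff it is scalar (finite check). -/
theorem actFin_eq_self_iff_scalar (a b c d : F3) (hdet : a * d - b * c ≠ 0) :
    (∀ i, actFin a b c d i = i) ↔ (b = 0 ∧ c = 0 ∧ a = d) := by
  revert hdet; revert a b c d; decide

/-- The determinant of `g ∈ GL₂(𝔽₃)` in terms of its entries is non-zero. -/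
theorem det_entries (g : GL (Fin 2) F3) : g 0 0 * g 1 1 - g 0 1 * g 1 0 ≠ 0 := by
  have h : ((Matrix.GeneralLinearGroup.det g : F3ˣ) : F3) ≠ 0 := Units.ne_zero _
  rwa [Matrix.GeneralLinearGroup.val_det_apply, Matrix.det_fin_two] at h

/-- A matrix acts trivially on `ℙ¹(𝔽₃)` iff it is scalar. -/
theorem permHom_eq_one_iff (g : GL (Fin 2) F3) :
    permHom g = 1 ↔ g ∈ Subgroup.center (GL (Fin 2) F3) := by
  rw [Matrix.GeneralLinearGroup.mem_center_iff_val_mem_range_scalar, Set.mem_range]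
  constructor
  · intro h
    have h' : ∀ i, actFin (g 0 0) (g 0 1) (g 1 0) (g 1 1) i = i := fun i => by
      rw [← permHom_apply, h]; rfl
    obtain ⟨hb, hc, had⟩ := (actFin_eq_self_iff_scalar _ _ _ _ (det_entries g)).1 h'
    refine ⟨g 0 0, ?_⟩
    ext i j
    fin_cases i <;> fin_cases j <;> simp [hb, hc, had]
  · rintro ⟨r, hr⟩
    have h00 : g 0 0 = r := by
      have := congrFun (congrFun hr 0) 0; simpa using this.symm
    have h01 : g 0 1 = 0 := by
      have := congrFun (congrFun hr 0) 1; simpa using this.symm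
    have h10 : g 1 0 = 0 := by
      have := congrFun (congrFun hr 1) 0; simpa using this.symm
    have h11 : g 1 1 = r := by
      have := congrFun (congrFun hr 1) 1; simpa using this.symm
    ext i : 1
    rw [permHom_apply, h00, h01, h10, h11]
    have h := (actFin_eq_self_iff_scalar r 0 0 r (by
      have := det_entries g; rwa [h00, h01, h10, h11] at this)).2 ⟨rfl, rfl, rfl⟩
    exact h i

/-- The action descends to `PGL₂(𝔽₃) → S₄`. -/
def permPGL : PGL(2, F3) →* Equiv.Perm (Fin 4) :=
  Matrix.ProjGenLinGroup.lift permHom (by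
    ext u : 1
    simp only [MonoidHom.coe_comp, Function.comp_apply, MonoidHom.one_apply]
    rw [permHom_eq_one_iff]
    exact Matrix.GeneralLinearGroup.mem_center_iff_val_mem_range_scalar.2 ⟨u, rfl⟩)

/-- Unfolding `permPGL` on classes of matrices. -/
@[simp] theorem permPGL_mk (g : GL (Fin 2) F3) : permPGL (Matrix.ProjGenLinGroup.mk g) = permHom g := rfl

/-- `PGL₂(𝔽₃) → S₄` is injective. -/
theorem permPGL_injective : Function.Injective permPGL := by
  rw [injective_iff_map_eq_one]
  intro x hx
  induction x using Matrix.ProjGenLinGroup.induction_on with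
  | _ g =>
    rw [permPGL_mk, permHom_eq_one_iff] at hx
    exact Matrix.ProjGenLinGroup.mk_eq_one.2 hx

/-- An explicit element of `GL₂(𝔽₃)` from four entries with non-zero determinant. -/
def glOf (a b c d : F3) (h : a * d - b * c ≠ 0) : GL (Fin 2) F3 :=
  Matrix.GeneralLinearGroup.mkOfDetNeZero (!![a, b; c, d] : Matrix (Fin 2) (Fin 2) F3)
    (by rwa [Matrix.det_fin_two_of])

/-- Entries of `glOf`. -/
@[simp] theorem glOf_apply (a b c d : F3) (h) (i j : Fin 2) :
    (glOf a b c d h : Matrix (Fin 2) (Fin 2) F3) i j = (!![a, b; c, d] : Matrix (Fin 2) (Fin 2) F3) i j := rfl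

/-- The permutation induced by `glOf a b c d`. -/
theorem permHom_glOf (a b c d : F3) (h) (i : Fin 4) : permHom (glOf a b c d h) i = actFin a b c d i := by
  rw [permHom_apply]; rfl

/-- Every transposition is induced by a matrix. -/
theorem swap_mem_range (i j : Fin 4) (hij : i ≠ j) : Equiv.swap i j ∈ permHom.range := by
  -- the six transpositions are realised by explicit matrices
  have key : ∀ (a b c d : F3) (h : a * d - b * c ≠ 0) (i j : Fin 4),
      (∀ x, actFin a b c d x = Equiv.swap i j x) → Equiv.swap i j ∈ permHom.range := by
    intro a b c d h i j hx
    exact ⟨glOf a b c d h, Equiv.ext fun x => by rw [permHom_glOf, hx]⟩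
  revert hij
  revert i j
  intro i j
  fin_cases i <;> fin_cases j <;> intro hij
  all_goals first
    | exact absurd rfl hij
    | exact key 0 1 1 0 (by decide) _ _ (by decide)
    | exact key 1 0 0 2 (by decide) _ _ (by decide)
    | exact key 1 0 1 2 (by decide) _ _ (by decide)
    | exact key 1 0 2 2 (by decide) _ _ (by decide)
    | exact key 1 1 0 2 (by decide) _ _ (by decide)
    | exact key 1 2 0 2 (by decide) _ _ (by decide)

/-- `GL₂(𝔽₃) → S₄` is surjective (transpositions generate). -/
theorem permHom_range_eq_top : permHom.range = ⊤ := by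
  rw [eq_top_iff, ← Equiv.Perm.closure_isSwap, Subgroup.closure_le]
  rintro σ ⟨i, j, hij, rfl⟩
  exact swap_mem_range i j hij

/-- `PGL₂(𝔽₃) → S₄` is surjective. -/
theorem permPGL_surjective : Function.Surjective permPGL := by
  intro σ
  obtain ⟨g, hg⟩ : σ ∈ permHom.range := by rw [permHom_range_eq_top]; trivial
  exact ⟨Matrix.ProjGenLinGroup.mk g, by rw [permPGL_mk, hg]⟩

/-- **`S₄ ≅ PGL₂(𝔽₃)`**: the inverse of the permutation action on `ℙ¹(𝔽₃)`. -/
def thetaPGL : Equiv.Perm (Fin 4) ≃* PGL(2, F3) :=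
  (MulEquiv.ofBijective permPGL ⟨permPGL_injective, permPGL_surjective⟩).symm

/-- `permPGL` is a left inverse of `thetaPGL`. -/
theorem permPGL_thetaPGL (σ : Equiv.Perm (Fin 4)) : permPGL (thetaPGL σ) = σ :=
  (MulEquiv.ofBijective permPGL ⟨permPGL_injective, permPGL_surjective⟩).apply_symm_apply σ

/-- `thetaPGL` sends the permutation of `g` to the class of `g`. -/
theorem thetaPGL_mk (g : GL (Fin 2) F3) : thetaPGL (permHom g) = Matrix.ProjGenLinGroup.mk g := by
  apply permPGL_injective
  rw [permPGL_thetaPGL, permPGL_mk]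

/-- Every permutation of the four points is induced by a matrix lifting its image in `PGL₂(𝔽₃)`. -/
theorem exists_gl_of_perm (σ : Equiv.Perm (Fin 4)) :
    ∃ g : GL (Fin 2) F3, Matrix.ProjGenLinGroup.mk g = thetaPGL σ ∧ permHom g = σ := by
  obtain ⟨g, hg⟩ := Matrix.ProjGenLinGroup.mk_surjective (thetaPGL σ)
  exact ⟨g, hg, by rw [← permPGL_mk, hg, permPGL_thetaPGL]⟩

/-- A matrix lifting `thetaPGL σ` induces `σ`. -/
theorem permHom_eq_of_mk_eq {g : GL (Fin 2) F3} {σ : Equiv.Perm (Fin 4)}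
    (h : Matrix.ProjGenLinGroup.mk g = thetaPGL σ) : permHom g = σ := by
  rw [← permPGL_mk, h, permPGL_thetaPGL]

end Summit.Langlands.Langlands.Theorems.ResidualAutomorphyOdd
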